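import Literature.Probability.RandomPlanarGeometry.RadialLoewnerDiscMaps
import Mathlib.MeasureTheory.Integral.IntervalIntegral.FundThmCalculus
import HarnessLib

/-!
# The normalisation `g_t'(0) = eᵗ` of the radial Loewner maps of the disc

Topic `Probability/RandomPlanarGeometry`; theorems only, sequel of `RadialLoewnerDiscMaps`. For a
continuous driver `U` the radial Loewner map `g_t = RadialLoewner.Disc.map U t` of the unit disc
(LSW/Lawler convention `ġ = g (ξ + g)/(ξ - g)`, `g_t(0) = 0`) has derivative `eᵗ` at the origin:

  `g_t'(0) = eᵗ`   (`hasDerivAt_map_zero`, `deriv_map_zero`),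

LSW (2002), (2.6) / Lawler (2005), §4.2 ("`g_t` is the conformal transformation of `D_t` onto `𝔻`
with `g_t(0) = 0` and `g_t'(0) > 0`. In fact, `g_t'(0) = eᵗ`"; Lawler's §6.4). Proof (the printed
one-liner "differentiate the equation at `z = 0`", made honest): along a solution from `z ≠ 0`,
`g_t(z) = z exp ∫₀ᵗ (ξ_s + g_s(z))/(ξ_s - g_s(z)) ds` (`IsSolution.eq_mul_exp_integral`, the
logarithmic derivative of the equation); `|g_s(z)| ≤ |g_t(z)|` for `s ≤ t`
(`IsSolution.norm_mono`, since `(1 - |g|²)²` decreases); hence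
`|∫₀ᵗ … ds - t| ≤ 4t |g_t(z)| → 0` as `z → 0` (`g_t` is continuous at `0`, `RadialLoewnerDiscMaps`),
and `g_t(z)/z → eᵗ`.

## References

* G. F. Lawler, *Conformally Invariant Processes in the Plane*, AMS (2005), §4.2, §6.4. [Lawler2005]
* G. F. Lawler, O. Schramm, W. Werner, *One-arm exponent for critical 2D percolation*, EJP 7
  (2002), §2, (2.6). [LawlerSchrammWernerEJP2002]
-/

noncomputable section

open Set Filter Topology Complex Metric
open scoped NNReal

namespace Literature.Probability.RandomPlanarGeometry

namespace RadialLoewner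

namespace Disc

variable {U : ℝ≥0 → ℝ} {z : ℂ} {g : ℝ → ℂ} {T : WithTop ℝ≥0}

/-! ### Along a solution: monotone modulus and the exponential formula -/

/-- **The modulus increases along an interior solution**: `|g_s| ≤ |g_t|` for `0 ≤ s ≤ t < T`
(`(1 - |g|²)²` is non-increasing and `|g| < 1`). [cite: Lawler2005, §4.2] -/
theorem IsSolution.norm_mono (hU : Continuous U) (h : IsSolution U z g T) (hz : ‖z‖ < 1)
    {s t : ℝ} (hs : 0 ≤ s) (hst : s ≤ t) (htT : (t.toNNReal : WithTop ℝ≥0) < T) :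
    ‖g s‖ ≤ ‖g t‖ := by
  have hsT : (s.toNNReal : WithTop ℝ≥0) < T :=
    lt_of_le_of_lt (WithTop.coe_le_coe.2 (Real.toNNReal_le_toNNReal hst)) htT
  have hsD : s ∈ timeDom T := ⟨hs, hsT⟩
  have htD : t ∈ timeDom T := ⟨hs.trans hst, htT⟩
  have hanti := h.antitoneOn_sq_one_sub_normSq hsD htD hst
  have hgs : ‖g s‖ < 1 := h.norm_lt_one hU hz hs hsT
  have hgt : ‖g t‖ < 1 := h.norm_lt_one hU hz (hs.trans hst) htT
  have h1 : 0 ≤ 1 - Complex.normSq (g t) := by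
    rw [Complex.normSq_eq_norm_sq]; nlinarith [norm_nonneg (g t)]
  have h2 : 0 ≤ 1 - Complex.normSq (g s) := by
    rw [Complex.normSq_eq_norm_sq]; nlinarith [norm_nonneg (g s)]
  have h3 : 1 - Complex.normSq (g t) ≤ 1 - Complex.normSq (g s) :=
    (pow_le_pow_iff_left₀ h1 h2 two_ne_zero).1 hanti
  rw [Complex.normSq_eq_norm_sq, Complex.normSq_eq_norm_sq] at h3
  nlinarith [norm_nonneg (g s), norm_nonneg (g t)]

/-- The logarithmic-derivative coefficient `(ξ_r + g_r)/(ξ_r - g_r)` is continuous on `[0, b]`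
along a solution alive beyond `b`. [folklore] -/
theorem IsSolution.continuousOn_coeff (hU : Continuous U) (h : IsSolution U z g T) {b : ℝ}
    (hbT : (b.toNNReal : WithTop ℝ≥0) < T) :
    ContinuousOn (fun r ↦ (drivingPt U r + g r) / (drivingPt U r - g r)) (Icc 0 b) := by
  have hsub : Icc 0 b ⊆ timeDom T := Loewner.Icc_subset_timeDomain hbT
  have hg : ContinuousOn g (Icc 0 b) := h.continuousOn.mono hsub
  have hξ : Continuous (drivingPt U) := continuous_drivingPt hU
  refine (hξ.continuousOn.add hg).div (hξ.continuousOn.sub hg) fun r hr ↦ ?_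
  exact sub_ne_zero.2 (h.ne hr.1 (hsub hr).2).symm

/-- **The exponential formula along a solution**: `g_b = z · exp ∫₀ᵇ (ξ_r + g_r)/(ξ_r - g_r) dr`
(the logarithmic derivative of `ġ = g (ξ + g)/(ξ - g)`). [cite: Lawler2005, §4.2] -/
theorem IsSolution.eq_mul_exp_integral (hU : Continuous U) (h : IsSolution U z g T) {b : ℝ}
    (hb : 0 ≤ b) (hbT : (b.toNNReal : WithTop ℝ≥0) < T) :
    g b = z * Complex.exp (∫ r in (0 : ℝ)..b, (drivingPt U r + g r) / (drivingPt U r - g r)) := by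
  have hsub : Icc 0 b ⊆ timeDom T := Loewner.Icc_subset_timeDomain hbT
  set c : ℝ → ℂ := fun r ↦ (drivingPt U r + g r) / (drivingPt U r - g r) with hcdef
  -- clamp the time to `[0, b]` to get a globally continuous integrand
  set k : ℝ → ℝ := fun r ↦ max 0 (min r b) with hkdef
  have hk : Continuous k := continuous_const.max (continuous_id.min continuous_const)
  have hkmem : ∀ r, k r ∈ Icc 0 b := fun r ↦ ⟨le_max_left _ _, max_le hb (min_le_right _ _)⟩
  have hkid : ∀ r ∈ Icc 0 b, k r = r := fun r hr ↦ by
    simp only [hkdef, min_eq_left hr.2, max_eq_right hr.1]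
  have hcc : Continuous (c ∘ k) := (h.continuousOn_coeff hU hbT).comp_continuous hk hkmem
  set I : ℝ → ℂ := fun s ↦ ∫ r in (0 : ℝ)..s, (c ∘ k) r with hIdef
  have hI : ∀ s, HasDerivAt I ((c ∘ k) s) s := fun s ↦ (hcc.integral_hasStrictDerivAt 0 s).hasDerivAt
  -- `Φ = g · exp (-I)` has zero right derivative on `[0, b)`
  set Φ : ℝ → ℂ := fun s ↦ g s * Complex.exp (-I s) with hΦdef
  have hderiv : ∀ s ∈ Ico 0 b, HasDerivWithinAt Φ 0 (Ici s) s := by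
    intro s hs
    have hg' := h.hasDerivWithinAt_Ici hsub s hs
    have hE : HasDerivWithinAt (fun s ↦ Complex.exp (-I s)) (Complex.exp (-I s) * -((c ∘ k) s)) (Ici s) s :=
      ((hI s).neg.cexp).hasDerivWithinAt
    have hprod := hg'.mul hE
    have hks : (c ∘ k) s = c s := by simp only [Function.comp_apply, hkid s ⟨hs.1, hs.2.le⟩]
    have hfield : field U s (g s) = g s * c s := by
      simp only [hcdef, field_apply, mul_div_assoc]
    rw [hks, hfield] at hprod
    exact (hprod.congr_deriv (by ring) : HasDerivWithinAt (fun s ↦ g s * Complex.exp (-I s)) 0 (Ici s) s)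
  have hcont : ContinuousOn Φ (Icc 0 b) := by
    refine (h.continuousOn.mono hsub).mul ?_
    exact (Complex.continuous_exp.comp (continuous_neg.comp
      (continuous_iff_continuousAt.2 fun s ↦ (hI s).continuousAt))).continuousOn
  have hconst := constant_of_has_deriv_right_zero hcont hderiv b (right_mem_Icc.2 hb)
  -- unwind: `Φ b = Φ 0 = z`
  have hI0 : I 0 = 0 := by simp [hIdef]
  simp only [hΦdef, hI0, neg_zero, Complex.exp_zero, mul_one, h.apply_zero] at hconst
  -- the clamped integral is the plain one
  have hIb : I b = ∫ r in (0 : ℝ)..b, c r := by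
    simp only [hIdef]
    refine intervalIntegral.integral_congr fun r hr ↦ ?_
    rw [uIcc_of_le hb] at hr
    simp only [Function.comp_apply, hkid r hr]
  calc g b = g b * Complex.exp (-I b) * Complex.exp (I b) := by
        rw [mul_assoc, ← Complex.exp_add, neg_add_cancel, Complex.exp_zero, mul_one]
    _ = z * Complex.exp (∫ r in (0 : ℝ)..b, c r) := by rw [hconst, hIb]

/-- **The logarithmic integral is close to `b`**: if `|g_b| ≤ 1/2` then
`|∫₀ᵇ (ξ + g)/(ξ - g) dr - b| ≤ 4 b |g_b|` (pointwise `|(ξ+g)/(ξ-g) - 1| = |2g/(ξ-g)| ≤ 2|g|/(1-|g|)`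
and `|g_r| ≤ |g_b| ≤ 1/2`). [cite: Lawler2005, §4.2] -/
theorem IsSolution.norm_integral_coeff_sub_le (hU : Continuous U) (h : IsSolution U z g T)
    (hz : ‖z‖ < 1) {b : ℝ} (hb : 0 ≤ b) (hbT : (b.toNNReal : WithTop ℝ≥0) < T)
    (hsmall : ‖g b‖ ≤ 1 / 2) :
    ‖(∫ r in (0 : ℝ)..b, (drivingPt U r + g r) / (drivingPt U r - g r)) - b‖ ≤ 4 * b * ‖g b‖ := by
  have hsub : Icc 0 b ⊆ timeDom T := Loewner.Icc_subset_timeDomain hbT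
  have hci : IntervalIntegrable (fun r ↦ (drivingPt U r + g r) / (drivingPt U r - g r)) MeasureTheory.volume 0 b :=
    ((h.continuousOn_coeff hU hbT).mono (by rw [uIcc_of_le hb])).intervalIntegrable
  have hsub1 : (∫ r in (0 : ℝ)..b, (drivingPt U r + g r) / (drivingPt U r - g r)) - b =
      ∫ r in (0 : ℝ)..b, ((drivingPt U r + g r) / (drivingPt U r - g r) - 1) := by
    rw [intervalIntegral.integral_sub hci (by simp), intervalIntegral.integral_const, sub_zero,
      Complex.real_smul, mul_one]
  rw [hsub1]
  have hbound : ∀ r ∈ Set.uIoc (0 : ℝ) b, ‖(drivingPt U r + g r) / (drivingPt U r - g r) - 1‖ ≤ 4 * ‖g b‖ := by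
    intro r hr
    rw [uIoc_of_le hb] at hr
    have hr0 : 0 ≤ r := hr.1.le
    have hrT : (r.toNNReal : WithTop ℝ≥0) < T :=
      lt_of_le_of_lt (WithTop.coe_le_coe.2 (Real.toNNReal_le_toNNReal hr.2)) hbT
    have hne : drivingPt U r - g r ≠ 0 := sub_ne_zero.2 (h.ne hr0 hrT).symm
    have hgr : ‖g r‖ ≤ ‖g b‖ := h.norm_mono hU hz hr0 hr.2 hbT
    have hden : 1 - ‖g r‖ ≤ ‖drivingPt U r - g r‖ := by
      have := norm_sub_norm_le (drivingPt U r) (g r)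
      rwa [norm_drivingPt] at this
    have hpos : 0 < 1 - ‖g r‖ := by linarith
    rw [div_sub_one hne, show drivingPt U r + g r - (drivingPt U r - g r) = 2 * g r by ring,
      norm_div, norm_mul, Complex.norm_two]
    calc 2 * ‖g r‖ / ‖drivingPt U r - g r‖ ≤ 2 * ‖g r‖ / (1 - ‖g r‖) := by
          gcongr
      _ ≤ 4 * ‖g b‖ := by
          rw [div_le_iff₀ hpos]
          nlinarith [norm_nonneg (g r)]
  have := intervalIntegral.norm_integral_le_of_norm_le_const hbound
  rw [sub_zero, abs_of_nonneg hb] at this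
  linarith

/-! ### The derivative at the origin -/

/-- **`g_t(z)/z → eᵗ` as `z → 0`.** [cite: Lawler2005, §4.2] -/
theorem tendsto_map_div_self (hU : Continuous U) (u : ℝ≥0) :
    Tendsto (fun w ↦ map U u w / w) (𝓝[≠] 0) (𝓝 (Real.exp u : ℂ)) := by
  set D := domain U u
  have hD : D ∈ 𝓝 (0 : ℂ) := (isOpen_domain hU u).mem_nhds (zero_mem_domain U u)
  -- continuity of `g_u` at `0`
  have h0 : ContinuousAt (map U u) 0 := (continuousOn_map hU u).continuousAt hD
  rw [nhdsWithin_restrict'' _ (mem_nhdsWithin_of_mem_nhds hD), ← sdiff_eq_compl_inter]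
  rw [Metric.tendsto_nhdsWithin_nhds]
  intro ε hε
  -- modulus of continuity of `exp` at `u`
  obtain ⟨η, hη, hexp⟩ := Metric.continuousAt_iff.1 (Complex.continuous_exp.continuousAt (x := (u : ℂ))) ε hε
  -- smallness of `g_u` near `0`
  have hu0 : (0 : ℝ) ≤ u := u.coe_nonneg
  obtain ⟨δ, hδ, hsmall⟩ := Metric.continuousAt_iff.1 h0 (min (1 / 2) (η / (4 * u + 1))) (by positivity)
  refine ⟨δ, hδ, fun w hw hwδ ↦ ?_⟩
  obtain ⟨hwD, hw0⟩ := hw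
  have hw0' : w ≠ 0 := hw0
  -- the solution from `w`, alive beyond `u`
  obtain ⟨hw1, hwT⟩ := (mem_domain_iff U u w).1 hwD
  obtain ⟨G, hG⟩ := exists_isSolution_swallowingTime hU w
  have huT : ((u : ℝ).toNNReal : WithTop ℝ≥0) < swallowingTime U w := by rwa [Real.toNNReal_coe]
  have hmap : map U u w = G u := map_eq_of_isSolution hU hG hwT
  have hgs : ‖G u‖ < min (1 / 2) (η / (4 * u + 1)) := by
    have := hsmall hwδ
    rwa [map_zero hU, dist_zero_right, hmap] at this
  have hg12 : ‖G u‖ ≤ 1 / 2 := (hgs.trans_le (min_le_left _ _)).le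
  have hgη : ‖G u‖ < η / (4 * u + 1) := hgs.trans_le (min_le_right _ _)
  -- exponential formula and the bound
  have hform := hG.eq_mul_exp_integral hU hu0 huT
  have hbound := hG.norm_integral_coeff_sub_le hU (mem_ball_zero_iff.1 hw1) hu0 huT hg12
  set J := ∫ r in (0 : ℝ)..(u : ℝ), (drivingPt U r + G r) / (drivingPt U r - G r)
  have hJ : dist J (u : ℂ) < η := by
    rw [dist_eq_norm]
    refine hbound.trans_lt ?_
    have h45 : 4 * (u : ℝ) * ‖G u‖ ≤ (4 * u + 1) * ‖G u‖ := by nlinarith [norm_nonneg (G u)]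
    refine h45.trans_lt ?_
    rwa [lt_div_iff₀ (by positivity), mul_comm] at hgη
  have := hexp hJ
  rw [hmap, hform, mul_div_cancel_left₀ _ hw0', Complex.ofReal_exp]
  exact this

/-- **`g_t'(0) = eᵗ`**: the radial Loewner map of the disc has derivative `eᵗ` at the origin
(LSW (2002), (2.6); Lawler (2005), §4.2 "In fact, `g_t'(0) = eᵗ`"). [cite: Lawler2005, §4.2] -/
theorem hasDerivAt_map_zero (hU : Continuous U) (u : ℝ≥0) :
    HasDerivAt (map U u) (Real.exp u : ℂ) 0 := by
  rw [hasDerivAt_iff_tendsto_slope_zero]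
  refine (tendsto_map_div_self hU u).congr' ?_
  refine eventually_nhdsWithin_of_forall fun w _ ↦ ?_
  show map U u w / w = w⁻¹ • (map U u (0 + w) - map U u 0)
  rw [zero_add, map_zero hU, sub_zero, smul_eq_mul, div_eq_inv_mul]

/-- `deriv g_t 0 = eᵗ`. [cite: Lawler2005, §4.2] -/
theorem deriv_map_zero (hU : Continuous U) (u : ℝ≥0) : deriv (map U u) 0 = Real.exp u :=
  (hasDerivAt_map_zero hU u).deriv

end Disc

end RadialLoewner

end Literature.Probability.RandomPlanarGeometry
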